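import Summits.KontsevichZagierPeriods.KontsevichZagierPeriods.Theorems.RootDecompWalshStrataHtypeLines

/-!
# Root decomposition (Walsh strata), part 51b — H-type fibre discriminants V′: line sections assembled

`R-HL ⟸ R-HLx` (`InBaker.of_Hlines`): a section of the vertex chart over a line edge `y = κ₀ + κ₁ x` of an
H-type cell is split by the sign of `N(ζ)/2 = κ₁ g − e κ₀ ζ`; the two signed pieces are pulled back to the
`x`-line by `InBaker.of_Hline_piece` (part 51), and the level set `N(ζ) = 0` is a constant section with a
`ℚ`-rational integrand, an empty set, or a null set.  `R-HLx` is the one-variable Euler-type family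

  `∫ γ (e x³/3 + g x) √(e x² + g − m (κ₀ + κ₁ x)²) (κ₁ g − e κ₀ x)/(e x² + g)² dx`

over semialgebraic subsets of `[0, 1]` on which `e x² + g > m (κ₀ + κ₁ x)²`.

References: [KontsevichZagier2001 §1.2 rules (1)–(3)], [BCR1998 §2.2].
-/

noncomputable section

open Set MeasureTheory MvPolynomial Literature.NumberTheory.Transcendental
open Literature.ModelTheory.ExponentialFields (IsSemialgebraic isSemialgebraic_univ isSemialgebraic_empty)
open Summit.KontsevichZagierPeriods.RootDecompWalshStrata.ConicDescent.VertexChart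

namespace Summit.KontsevichZagierPeriods.RootDecompWalshStrata.ConicDescent.BallCube

/-! #### 51.3 `R-HL` from `R-HLx` -/

/-- **Line sections of the vertex chart.**  The residual family `R-HL` (sections over a line edge
`k₀ + k₁ x + k₂ y = 0`, `k₂ ≠ 0`, of an H-type cell) follows from the one-variable family `R-HLx`: split the
section by the sign of `N(ζ)/2 = κ₁ g − e κ₀ ζ` (`κᵢ = −kᵢ/k₂`); the two signed pieces are pulled back to the
`x`-line (`InBaker.of_Hline_piece`), and on the level set `N(ζ) = 0` either `ζ` is the rational constant
`κ₁ g/(e κ₀)` (rational integrand, rule (1)), or `κ₀ = 0` and the piece is empty (`κ₁ = 0` or `g ≠ 0`) or a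
null set (`g = 0`: `κ₁²(1 + m v²)² = 4 e v²`). [KontsevichZagier2001 §1.2 rules (1)–(3); this node] -/
theorem InBaker.of_Hlines
    (hX : (∀ (e g m γ k0 k1 : ℚ), 0 < e → 1 ≤ m →
      ∀ (S : Set (Fin 1 → ℝ)), IsSemialgebraic ℚ S →
        (∀ t ∈ S, (0 ≤ t 0 ∧ t 0 ≤ 1) ∧ 0 < (e : ℝ) * t 0 ^ 2 + g ∧
          (m : ℝ) * ((k0 : ℝ) + k1 * t 0) ^ 2 < (e : ℝ) * t 0 ^ 2 + g) →
        ∀ r : KZ.IntegralRep 1, r.domain = S →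
          EqOn r.integrand (fun t => (γ : ℝ) * ((e : ℝ) / 3 * t 0 ^ 3 + g * t 0) *
            √((e : ℝ) * t 0 ^ 2 + g - m * ((k0 : ℝ) + k1 * t 0) ^ 2) *
            (((k1 : ℝ) * g - e * k0 * t 0) / ((e : ℝ) * t 0 ^ 2 + g) ^ 2)) S →
          InBaker (KZ.of r))) :
    (∀ (e g m γ : ℚ), 0 < e → 1 ≤ m → ∀ (L : Wall), L.k2 ≠ 0 →
      ∀ (T : Set (Fin 1 → ℝ)) (ζ : (Fin 1 → ℝ) → ℝ), IsSemialgebraic ℚ T → T ⊆ Icc 0 1 →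
        IsSemialgebraicFunOn ℚ T ζ → ContinuousOn ζ T →
        (∀ b ∈ T, (0 < b 0 ∧ (m : ℝ) * b 0 ^ 2 < 1) ∧ (0 ≤ ζ b ∧ ζ b ≤ 1) ∧
          0 < (e : ℝ) * ζ b ^ 2 + g ∧
          L.eval (ζ b) (√((e : ℝ) * ζ b ^ 2 + g) * gU m (b 0)) = 0) →
        ∀ r : KZ.IntegralRep 1, r.domain = T →
          EqOn r.integrand (fun b => (γ : ℝ) * ((e : ℝ) / 3 * ζ b ^ 3 + g * ζ b) * gW m (b 0)) T →
          InBaker (KZ.of r)) := by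
  classical
  intro e g m γ he hm L hk2 T ζ hT hTI hζ hζc hF r hrd hri
  have hm0 : (0 : ℚ) ≤ m := zero_le_one.trans hm
  have he' : (0 : ℝ) < e := by exact_mod_cast he
  have hk2' : (L.k2 : ℝ) ≠ 0 := by exact_mod_cast hk2
  obtain ⟨κ₀, hκ₀⟩ : ∃ κ₀ : ℚ, κ₀ = -L.k0 / L.k2 := ⟨_, rfl⟩
  obtain ⟨κ₁, hκ₁⟩ : ∃ κ₁ : ℚ, κ₁ = -L.k1 / L.k2 := ⟨_, rfl⟩
  have hA : ∀ b ∈ T, 0 < Polynomial.aeval (ζ b) (hP e g) := fun b hb => by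
    rw [aeval_hP]; exact (hF b hb).2.2.1
  -- the line relation solved for the ordinate: `√H(ζ)·U(v) = λ(ζ)`
  have hrel : ∀ b ∈ T, vS (hP e g) (ζ b) * gU m (b 0) = hLam κ₀ κ₁ (ζ b) := fun b hb => by
    have h := (hF b hb).2.2.2
    rw [Wall.eval] at h
    rw [vS, aeval_hP, hLam, hκ₀, hκ₁]
    push_cast
    field_simp
    linarith
  -- split by the sign of `N(ζ)/2`
  have hNζ : IsSemialgebraicFunOn ℚ T fun b => hNum e g κ₀ κ₁ (ζ b) :=
    (IsSemialgebraicFunOn.sub_holds (isSemialgebraicFunOn_ratCast hT (κ₁ * g))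
      ((isSemialgebraicFunOn_ratCast hT (e * κ₀)).mul_holds hζ)).congr fun b _ => by
        simp only [hNum, Pi.sub_apply, Pi.mul_apply]
        push_cast
        ring
  set Tp : Set (Fin 1 → ℝ) := {b | b ∈ T ∧ 0 < hNum e g κ₀ κ₁ (ζ b)} with hTp
  set Tn : Set (Fin 1 → ℝ) := {b | b ∈ T ∧ hNum e g κ₀ κ₁ (ζ b) < 0} with hTn
  set Tz : Set (Fin 1 → ℝ) := {b | b ∈ T ∧ hNum e g κ₀ κ₁ (ζ b) = ((0 : ℚ) : ℝ)} with hTz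
  have hTp' : IsSemialgebraic ℚ Tp := IsSemialgebraicFunOn.isSemialgebraic_sep_pos hNζ
  have hTn' : IsSemialgebraic ℚ Tn := hNζ.isSemialgebraic_sep_neg
  have hTz' : IsSemialgebraic ℚ Tz := isSemialgebraic_sep_eq hNζ (isSemialgebraicFunOn_ratCast hT 0)
  let A : Bool ⊕ Unit → Set (Fin 1 → ℝ) := fun o =>
    match o with
    | Sum.inl true => Tp
    | Sum.inl false => Tn
    | Sum.inr _ => Tz
  refine InBaker.of_cover' r A ?_ ?_ ?_
  · rintro ((_ | _) | _)
    · exact hTn'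
    · exact hTp'
    · exact hTz'
  · intro b hb
    have hbT : b ∈ T := hrd ▸ hb
    rcases lt_trichotomy (hNum e g κ₀ κ₁ (ζ b)) 0 with h | h | h
    · exact mem_iUnion.2 ⟨Sum.inl false, hbT, h⟩
    · exact mem_iUnion.2 ⟨Sum.inr (), hbT, by rw [h, Rat.cast_zero]⟩
    · exact mem_iUnion.2 ⟨Sum.inl true, hbT, h⟩
  · rintro ((_ | _) | _) T' hT' hTr hTA
    · -- `N(ζ) < 0`: pull back with `ς = −1`
      exact InBaker.of_Hline_piece hX he hm γ (ς := -1) (Or.inr rfl)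
        (fun b hb => ⟨(hF b (hTA hb).1).1, (hF b (hTA hb).1).2.1, hA b (hTA hb).1, hrel b (hTA hb).1, by
          rw [Rat.cast_neg, Rat.cast_one]
          have := (hTA hb).2
          linarith⟩)
        (r.restrict T' hT' hTr) rfl fun b hb => hri (hTA hb).1
    · -- `N(ζ) > 0`: pull back with `ς = 1`
      exact InBaker.of_Hline_piece hX he hm γ (ς := 1) (Or.inl rfl)
        (fun b hb => ⟨(hF b (hTA hb).1).1, (hF b (hTA hb).1).2.1, hA b (hTA hb).1, hrel b (hTA hb).1, by
          rw [Rat.cast_one, one_mul]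
          exact (hTA hb).2⟩)
        (r.restrict T' hT' hTr) rfl fun b hb => hri (hTA hb).1
    · -- `N(ζ) = 0`
      by_cases hκ : κ₀ ≠ 0
      · -- `ζ ≡ x₀ = κ₁ g/(e κ₀)`: rational integrand
        obtain ⟨x₀, hx₀⟩ : ∃ x₀ : ℚ, x₀ = κ₁ * g / (e * κ₀) := ⟨_, rfl⟩
        have heκ : (e : ℝ) * κ₀ ≠ 0 := mul_ne_zero he'.ne' (by exact_mod_cast hκ)
        have hxv : ∀ b ∈ T', ζ b = (x₀ : ℝ) := fun b hb => by
          have h := (hTA hb).2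
          rw [Rat.cast_zero] at h
          unfold hNum at h
          rw [hx₀]
          push_cast
          rw [eq_div_iff heκ]
          linarith
        refine InBaker.of_eqOn_aeval_div _
          (C (2 * γ * (e / 3 * x₀ ^ 3 + g * x₀)) * (1 - C m * X 0 ^ 2) ^ 2)
          ((1 + C m * X 0 ^ 2) ^ 3) (fun b _ => ?_) fun b hb => ?_
        · have h : (0 : ℝ) < (1 + (m : ℝ) * b 0 ^ 2) ^ 3 := pow_pos (one_add_pos hm0 (b 0)) 3
          simpa using h.ne'
        · show r.integrand b = _
          rw [hri (hTA hb).1]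
          dsimp only
          rw [hxv b hb]
          have hden : (1 + (m : ℝ) * b 0 ^ 2) ^ 3 ≠ 0 := (pow_pos (one_add_pos hm0 (b 0)) 3).ne'
          simp only [map_mul, map_pow, map_sub, map_add, map_one, MvPolynomial.aeval_C,
            MvPolynomial.aeval_X, eq_ratCast, gW]
          push_cast
          rw [eq_div_iff hden]
          field_simp
          try ring
      · rw [not_not] at hκ
        by_cases hκ1 : κ₁ = 0
        · -- `λ ≡ 0`: `√H·U(v) = 0` contradicts `v > 0`
          refine InBaker.of_domain_eq_empty _ (eq_empty_of_forall_notMem fun b hb => ?_)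
          have hbT := (hTA hb).1
          have h := hrel b hbT
          rw [hLam, hκ, hκ1, Rat.cast_zero, zero_mul, add_zero] at h
          exact (mul_pos (vS_pos (hA b hbT)) (gU_pos hm0 (hF b hbT).1.1)).ne' h
        by_cases hg0 : g = 0
        · -- `H = e x²`: the section lies in the null set `κ₁²(1 + m v²)² = 4 e v²`
          refine InBaker.of_subset_zeroSet _
            (C (κ₁ ^ 2) * (1 + C m * X 0 ^ 2) ^ 2 - C (4 * e) * X 0 ^ 2 : MvPolynomial (Fin 1) ℚ)
            ⟨fun _ => 0, by simp [hκ1]⟩ fun b hb => ?_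
          have hbT := (hTA hb).1
          have h := hrel b hbT
          obtain ⟨⟨hv0, -⟩, ⟨hz0, -⟩, hHp, -⟩ := hF b hbT
          rw [hg0, Rat.cast_zero, add_zero] at hHp
          have hz : 0 < ζ b := by
            rcases hz0.eq_or_lt with h0 | h0
            · rw [← h0] at hHp; norm_num at hHp
            · exact h0
          rw [hLam, hκ, Rat.cast_zero, zero_add, vS, aeval_hP, hg0, Rat.cast_zero, add_zero,
            Real.sqrt_mul' _ (sq_nonneg _), Real.sqrt_sq hz.le] at h
          -- cancel `ζ > 0`: `√e · U(v) = κ₁`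
          have h2 : (√(e : ℝ) * gU m (b 0) - κ₁) * ζ b = 0 := by linear_combination h
          have h3 : √(e : ℝ) * gU m (b 0) = κ₁ := by
            have := (mul_eq_zero.1 h2).resolve_right hz.ne'
            linarith
          have hsq : (e : ℝ) * gU m (b 0) ^ 2 = (κ₁ : ℝ) ^ 2 := by
            rw [← h3, mul_pow, Real.sq_sqrt he'.le]
          have hden : 1 + (m : ℝ) * b 0 ^ 2 ≠ 0 := (one_add_pos hm0 (b 0)).ne'
          rw [gU, div_pow] at hsq
          field_simp at hsq
          simp only [map_sub, map_mul, map_pow, map_add, map_one, MvPolynomial.aeval_C,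
            MvPolynomial.aeval_X, eq_ratCast]
          push_cast
          linear_combination -hsq
        · -- `g ≠ 0`: `N/2 ≡ κ₁ g ≠ 0`, the piece is empty
          refine InBaker.of_domain_eq_empty _ (eq_empty_of_forall_notMem fun b hb => ?_)
          have h := (hTA hb).2
          unfold hNum at h
          rw [hκ, Rat.cast_zero, mul_zero, zero_mul, sub_zero] at h
          exact mul_ne_zero (by exact_mod_cast hκ1 : (κ₁ : ℝ) ≠ 0) (by exact_mod_cast hg0 : (g : ℝ) ≠ 0) h

end Summit.KontsevichZagierPeriods.RootDecompWalshStrata.ConicDescent.BallCube
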